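import Summits.QuantumFields.YangMills.Theorems.BalabanUVNodesN15TwoSpacingGluingCurvedKnitCovariantLandau
import HarnessLib

/-!
# THE GLUING STEP AT TWO LATTICE SPACINGS — PROGRAMME (P-R), IX: THE LIVE-`U` KNIT AT THE COVER WITH BAŁABAN's FULLY COVARIANT SUMMAND IN THE GLOBAL SMALL-FIELD GAUGE —
# n15-c∕183 with the Landau summand `D_U(I − R(U))D*_U` live too; every row of FILE 120 produced EXCEPT the two Landau perturbation letters, displayed
# (dag-n15-c g22, n15-c∕204; N15 = NE2, s1)

Cell `pub-ymgap`, seat `pub-ymgap-dag-n15-c` (R134 (a); HUMAN RULING D-0062), generation 22.  `bears_on: R4∕N15 · K3⁸ SpineGivenEndpointR13SepCoPHV (stmt-QuantumFields-27366)`.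
Filed `--supports stmt-QuantumFields-27366 --as helper` — COUNT-NEUTRAL.  One theorem, no `def`, 0 `sorry`; NO new estimate (183's proof text with the summand of n15-c∕201).
Imports BY NAME n15-c∕201 `…CurvedKnitCovariantLandau` (`cvNVr`; through it 183 `cvT`∕`cvNVq`∕`sf_rows_cvT_sub_one_le`∕`sf_cols_cvT_sub_one_le`∕`hasMaj_sandwich_of_abs_le_one`, 182b
`hasMaj_nvQ`, 129 `sf_localCoefLetters`∕`conj_one_eq_sub_zero`, FILE 120 `uN_cvGlued_spec`).  Nothing in the tree modified ∕ restated.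

WHY.  n15-c∕202∕203 are the per-cube-gauge editions with all ∕ the perturbation rows displayed.  THIS FILE is the GLOBAL small-field gauge edition (the currency of FILES 129–196
and of every `NE2PlusOperator` certificate of this road): `u ≡ 1`, `U = e^{iηA}` with `A` Hermitian in the global (3.35) class — there the averaging perturbation `N_V^Q` IS small with
decay (n15-c∕182b∕183, discharged here exactly as in 183), and the ONLY displayed inputs are the two Landau letters of `N_V^R(e^{iηA}) = D_U(I−R(U))D*_U − ∂Π∂* ⊗ 1_ι`
(zero at `A = 0` by n15-c∕200∕201 `cvNVr_one`): near (`ψ_k N_V^R χ_k ≤ R_R e^{−δd}`) and far (`(1−ψ_k) N_V^R χ_k ≤ θ_R e^{−δd}`) — [Balaban1985BackgroundPropagators] Thm 3.2 ∕ (3.49) ∕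
Thm 3.3 in the model, the lane's located next analytic object.  Output: decay + two-sided inverse of the glued operator for the model of Bałaban's FULL `Δ_a(U)` of (3.26):
`Δ_{Ad e^{iηA}} + a·Q*(U)Q(U) − D_U(I−R(U))D*_U`.

WHAT.  ★★★ **`sfqr_cvGlued_spec`** (statement = 183's `sfq_cvGlued_spec` + the letters `R_R, θ_R` in the budget + the two displayed `N_V^R` rows; conclusion with `P := N_L⊗1 − N_V^Q − N_V^R`,
`N_V := N_V^Q + N_V^R`).

HONEST FRAMING ∕ LIMITS.  MODEL (global small-field gauge, doubled-torus cover, one averaging level, uniform weights in `Δ′_a`, one-level staircases, `Q(U)` = main term (125)); the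
Landau letters are NOT produced; NOT [Balaban1985BackgroundPropagators] Thm 3.1∕3.3 as printed; NE2⁺ NOT PRINTED; N15 of record untouched (DISCHARGED AS CONSUMED, p687738); counts
UNMOVED (typed 28∕28); one finite 𝕋⁴ at fixed ε per index — NOT infinite volume ∕ OS ∕ mass gap ∕ Clay.  Restate-immune (no Theses import).
-/

noncomputable section

open scoped BigOperators Matrix

namespace Summit.QuantumFields.YangMills.BalabanUVNodes.N15.Gluing

open Real
open Literature.MathematicalPhysics.QuantumFieldTheory.Balaban1983to89
open Literature.MathematicalPhysics.QuantumFieldTheory.Balaban1983to89.B11SectG (BlockNorm HasMaj)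
open Literature.MathematicalPhysics.QuantumFieldTheory.Balaban1983to89.B6Prop26Gluing (mulOp mulOp_apply)
open Literature.MathematicalPhysics.QuantumFieldTheory.Balaban1983to89.B6UnitTorusCarrier (unitTorusGeo unitTorusGeo_dist)
open Literature.MathematicalPhysics.QuantumFieldTheory.Balaban1983to89.B9Eq39Adjoint (covD fluct)
open Literature.Barriers.QuantumFields (traceForm)
open Summit.QuantumFields.YangMills.BalabanUVNodes.N15.BackgroundLayer (covLapM tCoefA tCoefC)
open Summit.QuantumFields.YangMills.BalabanUVNodes.N15.VectorPiece (bshiftEquiv)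
open Summit.QuantumFields.YangMills.BalabanUVNodes.N15.MatrixSpecies (mmulOp coordMat basisConst basisConst_nonneg liftBlk)
open Summit.QuantumFields.YangMills.BalabanUVNodes.N15.CurvedSpecies (gaugePair)
open Summit.QuantumFields.YangMills.BalabanUVNodes.N15.TwoGrid (chiCube abs_chiCube_le_one)
open Summit.QuantumFields.YangMills.BalabanUVNodes.N15.CovAvg (qvCov qvCovAdj hasMaj_nvQ)

variable {d : ℕ}

section Knit

open scoped Matrix.Norms.L2Operator

variable {L : ℕ} [NeZero L]

/-- ★★★ **THE LIVE-BACKGROUND KNIT AT THE COVER WITH BAŁABAN's FULLY COVARIANT SUMMAND `P(U) = a·Q*(U)Q(U) − D_U(I − R(U))D*_U` IN THE GLOBAL SMALL-FIELD GAUGE** (n15-c∕183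
`sfq_cvGlued_spec` with the Landau summand live as well: FILE 120 with `w ≡ 1`, `U := e^{iηA}`, `P := N_L ⊗ 1 − N_V^Q − N_V^R`, `N_V := N_V^Q + N_V^R`): for odd `L ≥ 7`, `a > 0`, a colour
index `ι` there are `δ, w₀, R₀, R₁, B > 0` such that on every doubled torus of the cover, for trace-form coordinates `e` of `𝔲(m)` (`m ≥ 1`), EVERY HERMITIAN bond field `A` with the
GLOBAL (3.35) letters (`‖A_μ(x)‖ < C∕ξ`, `‖η⁻¹∇^η_μA_ν(x)‖ < C∕ξ²`), row bounds `≤ r_V`, transporter size `K ≤ 1`, and Landau letters `R_R, θ_R ≥ 0` with `r_V(1+|J⊕J|) + R₁K + R_R ≤ R₀`,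
`R₁K + θ_R ≤ R₀`: IF the Landau perturbation `N_V^R(e^{iηA}) = D_U(I−R(U))D*_U − ∂Π∂* ⊗ 1_ι` is `≤ R_R e^{−δd}` between plateau and cut box and `≤ θ_R e^{−δd}` off the plateau
(DISPLAYED — the content of [B9] Thms 3.2–3.3 in the model), THEN the glued operator of the dressed smooth-cut Neumann cubes — gauges `1`, summand `P(U)`, perturbation
`N_V^Q + N_V^R` — is `≤ B·e^{−(δ∕16)d}` blockwise AND the two-sided inverse of `Δ_{Ad e^{iηA}} + a·Q*(U)Q(U) − D_U(I−R(U))D*_U` (the `N_V^Q` rows are discharged by n15-c∕182b as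
in 183).  MODEL (global gauge; doubled torus); NOT [B9] Thm 3.1∕3.3 as printed.
[cite: Balaban1985BackgroundPropagators, Thm 3.1 p.397 and Thm 3.3 p.399 (shape), (3.26) p.395, (3.34)–(3.35) p.396, (3.49) p.399, (3.50)–(3.52) p.400, (3.59)–(3.60) p.402; Balaban1985Averaging, (125)–(126) p.36; Balaban1984PropagatorsI, (1.69) p.29; Balaban1984PropagatorsII, (2.91)–(2.93) p.239] -/
theorem sfqr_cvGlued_spec (hL : Odd L ∧ 1 < L) (hL7 : 7 ≤ L) {a : ℝ} (ha : 0 < a) (ι : Type) [Fintype ι] [DecidableEq ι] :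
    ∃ δ w₀ R₀ R₁ B : ℝ, 0 < δ ∧ 0 < R₀ ∧ 0 < R₁ ∧ 0 < B ∧
      ∀ (mv kk : ℕ), 1 ≤ kk → w₀ ≤ ((L ^ mv : ℕ) : ℝ) →
      ∀ {mm : Type} [Fintype mm] [DecidableEq mm] [Nonempty mm] (e : Matrix mm mm ℂ ≃L[ℝ] (ι → ℝ)), (∀ A B : Matrix mm mm ℂ, traceForm A B = e A ⬝ᵥ e B) →
      ∀ (A : Fin (d + 1) → CvX d L mv kk hL → Matrix mm mm ℂ), (∀ μ x, (A μ x)ᴴ = A μ x) →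
      ∀ (ξ C : ℝ), 0 < ξ → 0 ≤ C → (∀ μ x, ‖A μ x‖ < C * ξ⁻¹) →
        (∀ μ ν x, ‖((((((L ^ kk : ℕ) : ℝ))⁻¹) : ℝ) : ℂ)⁻¹ • covD (bshiftEquiv (cvM d L mv kk hL) (L ^ kk)) (fun _ _ => (1 : (Matrix mm mm ℂ)ˣ)) μ (A ν) x‖ < C * (ξ ^ 2)⁻¹) →
      ∀ (rV : ℝ), 0 ≤ rV →
        Fintype.card ι * (@basisConst ι _ (Matrix mm mm ℂ) Matrix.frobeniusNormedAddCommGroup Matrix.frobeniusNormedSpace e * (2 * Real.sqrt (Fintype.card mm)) * (Real.sqrt (Fintype.card mm) * ((C / ξ) * Real.exp (((((L ^ kk : ℕ) : ℝ))⁻¹) * (C / ξ))))) ≤ rV →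
        Fintype.card ι * (Fintype.card (Fin (d + 1)) * (Fintype.card ι * (@basisConst ι _ (Matrix mm mm ℂ) Matrix.frobeniusNormedAddCommGroup Matrix.frobeniusNormedSpace e * (2 * Real.sqrt (Fintype.card mm)) * (Real.sqrt (Fintype.card mm) * ((C / ξ) * Real.exp (((((L ^ kk : ℕ) : ℝ))⁻¹) * (C / ξ))))) ^ 2 + @basisConst ι _ (Matrix mm mm ℂ) Matrix.frobeniusNormedAddCommGroup Matrix.frobeniusNormedSpace e * (2 * Real.sqrt (Fintype.card mm)) * (Real.sqrt (Fintype.card mm) * ((C / ξ ^ 2) * Real.exp (((((L ^ kk : ℕ) : ℝ))⁻¹) * (C / ξ)))))) ≤ rV →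
        (1 + Fintype.card ι * (@basisConst ι _ (Matrix mm mm ℂ) Matrix.frobeniusNormedAddCommGroup Matrix.frobeniusNormedSpace e * (2 * Real.sqrt (Fintype.card mm)) * (Real.sqrt (Fintype.card mm) * (((((L ^ kk : ℕ) : ℝ))⁻¹) * (C / ξ) * Real.exp (((((L ^ kk : ℕ) : ℝ))⁻¹) * (C / ξ)))))) ^ ((d + 2) * L ^ kk) - 1 ≤ 1 →
      ∀ (RR θR : ℝ), 0 ≤ RR → 0 ≤ θR →
        rV * (1 + Fintype.card (Fin (d + 1) ⊕ Fin (d + 1))) + R₁ * ((1 + Fintype.card ι * (@basisConst ι _ (Matrix mm mm ℂ) Matrix.frobeniusNormedAddCommGroup Matrix.frobeniusNormedSpace e * (2 * Real.sqrt (Fintype.card mm)) * (Real.sqrt (Fintype.card mm) * (((((L ^ kk : ℕ) : ℝ))⁻¹) * (C / ξ) * Real.exp (((((L ^ kk : ℕ) : ℝ))⁻¹) * (C / ξ)))))) ^ ((d + 2) * L ^ kk) - 1) + RR ≤ R₀ → R₁ * ((1 + Fintype.card ι * (@basisConst ι _ (Matrix mm mm ℂ) Matrix.frobeniusNormedAddCommGroup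 Matrix.frobeniusNormedSpace e * (2 * Real.sqrt (Fintype.card mm)) * (Real.sqrt (Fintype.card mm) * (((((L ^ kk : ℕ) : ℝ))⁻¹) * (C / ξ) * Real.exp (((((L ^ kk : ℕ) : ℝ))⁻¹) * (C / ξ)))))) ^ ((d + 2) * L ^ kk) - 1) + θR ≤ R₀ →
        (∀ k, HasMaj (CvNorm d L mv kk hL ι) (CvNorm d L mv kk hL ι) (mulOp (fun p : CvX d L mv kk hL × ι => cvPsi d L mv kk hL k p.1) ∘ₗ cvNVr d L mv kk hL a ι e (fun μ x => (fluct ((((L ^ kk : ℕ) : ℝ))⁻¹) A μ x : Matrix mm mm ℂ)) ∘ₗ mulOp (fun p : CvX d L mv kk hL × ι => cvChi d L mv kk hL k p.1)) (fun y y' => RR * Real.exp (-(δ * (unitTorusGeo L kk (cvM d L mv kk hL)).dist y y')))) →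
        (∀ k, HasMaj (CvNorm d L mv kk hL ι) (CvNorm d L mv kk hL ι) ((LinearMap.id - mulOp (fun p : CvX d L mv kk hL × ι => cvPsi d L mv kk hL k p.1)) ∘ₗ cvNVr d L mv kk hL a ι e (fun μ x => (fluct ((((L ^ kk : ℕ) : ℝ))⁻¹) A μ x : Matrix mm mm ℂ)) ∘ₗ mulOp (fun p : CvX d L mv kk hL × ι => cvChi d L mv kk hL k p.1)) (fun y y' => θR * Real.exp (-(δ * (unitTorusGeo L kk (cvM d L mv kk hL)).dist y y')))) →
                HasMaj (CvNorm d L mv kk hL ι) (CvNorm d L mv kk hL ι) (cvGlued d L mv kk hL a ((((L ^ kk : ℕ) : ℝ))⁻¹) ι e (fun _ _ => (1 : Matrix mm mm ℂ)) (fun μ x => (fluct ((((L ^ kk : ℕ) : ℝ))⁻¹) A μ x : Matrix mm mm ℂ))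
            (cvNL d L mv kk hL a ι - cvNVq d L mv kk hL a ι e (fun μ x => (fluct ((((L ^ kk : ℕ) : ℝ))⁻¹) A μ x : Matrix mm mm ℂ)) - cvNVr d L mv kk hL a ι e (fun μ x => (fluct ((((L ^ kk : ℕ) : ℝ))⁻¹) A μ x : Matrix mm mm ℂ))) (fun _ => cvNVq d L mv kk hL a ι e (fun μ x => (fluct ((((L ^ kk : ℕ) : ℝ))⁻¹) A μ x : Matrix mm mm ℂ)) + cvNVr d L mv kk hL a ι e (fun μ x => (fluct ((((L ^ kk : ℕ) : ℝ))⁻¹) A μ x : Matrix mm mm ℂ))))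
          (fun y y' => B * Real.exp (-(δ / 16 * (unitTorusGeo L kk (cvM d L mv kk hL)).dist y y'))) ∧
        (cvGlued d L mv kk hL a ((((L ^ kk : ℕ) : ℝ))⁻¹) ι e (fun _ _ => (1 : Matrix mm mm ℂ)) (fun μ x => (fluct ((((L ^ kk : ℕ) : ℝ))⁻¹) A μ x : Matrix mm mm ℂ))
            (cvNL d L mv kk hL a ι - cvNVq d L mv kk hL a ι e (fun μ x => (fluct ((((L ^ kk : ℕ) : ℝ))⁻¹) A μ x : Matrix mm mm ℂ)) - cvNVr d L mv kk hL a ι e (fun μ x => (fluct ((((L ^ kk : ℕ) : ℝ))⁻¹) A μ x : Matrix mm mm ℂ))) (fun _ => cvNVq d L mv kk hL a ι e (fun μ x => (fluct ((((L ^ kk : ℕ) : ℝ))⁻¹) A μ x : Matrix mm mm ℂ)) + cvNVr d L mv kk hL a ι e (fun μ x => (fluct ((((L ^ kk : ℕ) : ℝ))⁻¹) A μ x : Matrix mm mm ℂ))) ∘ₗ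
          (covLapM (bshiftEquiv (cvM d L mv kk hL) (L ^ kk)) ((((L ^ kk : ℕ) : ℝ))⁻¹) (gaugePair (bshiftEquiv (cvM d L mv kk hL) (L ^ kk)) (fun μ x => coordMat e (ContinuousLinearMap.mulLeftRight ℝ (Matrix mm mm ℂ) (fluct ((((L ^ kk : ℕ) : ℝ))⁻¹) A μ x : Matrix mm mm ℂ) (fluct ((((L ^ kk : ℕ) : ℝ))⁻¹) A μ x : Matrix mm mm ℂ)ᴴ))) +
            (cvNL d L mv kk hL a ι - cvNVq d L mv kk hL a ι e (fun μ x => (fluct ((((L ^ kk : ℕ) : ℝ))⁻¹) A μ x : Matrix mm mm ℂ)) - cvNVr d L mv kk hL a ι e (fun μ x => (fluct ((((L ^ kk : ℕ) : ℝ))⁻¹) A μ x : Matrix mm mm ℂ)))) = LinearMap.id ∧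
          (covLapM (bshiftEquiv (cvM d L mv kk hL) (L ^ kk)) ((((L ^ kk : ℕ) : ℝ))⁻¹) (gaugePair (bshiftEquiv (cvM d L mv kk hL) (L ^ kk)) (fun μ x => coordMat e (ContinuousLinearMap.mulLeftRight ℝ (Matrix mm mm ℂ) (fluct ((((L ^ kk : ℕ) : ℝ))⁻¹) A μ x : Matrix mm mm ℂ) (fluct ((((L ^ kk : ℕ) : ℝ))⁻¹) A μ x : Matrix mm mm ℂ)ᴴ))) +
            (cvNL d L mv kk hL a ι - cvNVq d L mv kk hL a ι e (fun μ x => (fluct ((((L ^ kk : ℕ) : ℝ))⁻¹) A μ x : Matrix mm mm ℂ)) - cvNVr d L mv kk hL a ι e (fun μ x => (fluct ((((L ^ kk : ℕ) : ℝ))⁻¹) A μ x : Matrix mm mm ℂ)))) ∘ₗ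
          cvGlued d L mv kk hL a ((((L ^ kk : ℕ) : ℝ))⁻¹) ι e (fun _ _ => (1 : Matrix mm mm ℂ)) (fun μ x => (fluct ((((L ^ kk : ℕ) : ℝ))⁻¹) A μ x : Matrix mm mm ℂ))
            (cvNL d L mv kk hL a ι - cvNVq d L mv kk hL a ι e (fun μ x => (fluct ((((L ^ kk : ℕ) : ℝ))⁻¹) A μ x : Matrix mm mm ℂ)) - cvNVr d L mv kk hL a ι e (fun μ x => (fluct ((((L ^ kk : ℕ) : ℝ))⁻¹) A μ x : Matrix mm mm ℂ))) (fun _ => cvNVq d L mv kk hL a ι e (fun μ x => (fluct ((((L ^ kk : ℕ) : ℝ))⁻¹) A μ x : Matrix mm mm ℂ)) + cvNVr d L mv kk hL a ι e (fun μ x => (fluct ((((L ^ kk : ℕ) : ℝ))⁻¹) A μ x : Matrix mm mm ℂ))) = LinearMap.id) := by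
  obtain ⟨δ, w₀, R₀, θ₀, B, hδ, hR₀, hθ₀, hB, H⟩ := uN_cvGlued_spec (d := d) hL hL7 ha ι
  -- the new constants: `R₀' = min R₀ θ₀`, `R₁ = 3|a|·c_{d+1}(δ)·e^{3δ} + 1`
  have hc0 : 0 ≤ B4Sect5Proof.latticeConst (d + 1) δ := B4Sect5Proof.latticeConst_nonneg (d + 1) hδ.le
  refine ⟨δ, w₀, min R₀ θ₀, 3 * |a| * (B4Sect5Proof.latticeConst (d + 1) δ * Real.exp (3 * δ)) + 1, B, hδ, lt_min hR₀ hθ₀, by positivity, hB, fun mv kk hk hw₀ => ?_⟩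
  intro mm _ _ _ e he A hA ξ C hξ hC hA1 hA2 rV hrV hrA hrC hK1 RR θR hRR hθR hRle hθRle hNr hFr
  have hη : (0 : ℝ) < ((((L ^ kk : ℕ) : ℝ))⁻¹) := inv_pos.mpr (Nat.cast_pos.mpr (pow_pos (Nat.pos_of_ne_zero (NeZero.ne L)) kk))
  have hlet := fun x => sf_localCoefLetters e (bshiftEquiv (cvM d L mv kk hL) (L ^ kk)) he hη hξ hC hA hA1 hA2 x
  -- the transporter letter `ρ` and its size `K`
  set ρ : ℝ := Fintype.card ι * (@basisConst ι _ (Matrix mm mm ℂ) Matrix.frobeniusNormedAddCommGroup Matrix.frobeniusNormedSpace e * (2 * Real.sqrt (Fintype.card mm)) *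
    (Real.sqrt (Fintype.card mm) * (((((L ^ kk : ℕ) : ℝ))⁻¹) * (C / ξ) * Real.exp (((((L ^ kk : ℕ) : ℝ))⁻¹) * (C / ξ))))) with hρdef
  set K : ℝ := (1 + ρ) ^ ((d + 2) * L ^ kk) - 1 with hKdef
  have hρ : 0 ≤ ρ := by
    have hκ := @basisConst_nonneg ι _ (Matrix mm mm ℂ) Matrix.frobeniusNormedAddCommGroup Matrix.frobeniusNormedSpace e
    have hCξ : 0 ≤ C / ξ := div_nonneg hC hξ.le
    rw [hρdef]; positivity
  have hK : 0 ≤ K := by have := one_le_pow₀ (M₀ := ℝ) (a := 1 + ρ) (by linarith) (n := (d + 2) * L ^ kk); rw [hKdef]; linarith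
  have hTr := sf_rows_cvT_sub_one_le (d := d) e hη hA (bshiftEquiv (cvM d L mv kk hL) (L ^ kk)) hA1 hA2
  have hTc := sf_cols_cvT_sub_one_le (d := d) e hη hA (bshiftEquiv (cvM d L mv kk hL) (L ^ kk)) hA1 hA2
  -- the letter of `N_V^Q` (n15-c∕182b) and its constant against `R₁K`
  have hNV := hasMaj_nvQ (L := L) (cvM d L mv kk hL) kk (L ^ kk) (T := cvT e (fun μ x => (fluct ((((L ^ kk : ℕ) : ℝ))⁻¹) A μ x : Matrix mm mm ℂ))) hρ hδ hTr hTc a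
  set R₁ : ℝ := 3 * |a| * (B4Sect5Proof.latticeConst (d + 1) δ * Real.exp (3 * δ)) + 1 with hR₁def
  have hconst : |a| * (K * (2 + K) * (B4Sect5Proof.latticeConst (d + 1) δ * Real.exp (3 * δ))) ≤ R₁ * K := by
    have h2K : K * (2 + K) ≤ 3 * K := by nlinarith
    have hce : 0 ≤ B4Sect5Proof.latticeConst (d + 1) δ * Real.exp (3 * δ) := mul_nonneg hc0 (Real.exp_nonneg _)
    rw [hR₁def]
    nlinarith [abs_nonneg a, mul_nonneg (abs_nonneg a) hce, mul_nonneg (mul_nonneg (abs_nonneg a) hce) hK]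
  have hNV' : HasMaj (CvNorm d L mv kk hL ι) (CvNorm d L mv kk hL ι) (cvNVq d L mv kk hL a ι e (fun μ x => (fluct ((((L ^ kk : ℕ) : ℝ))⁻¹) A μ x : Matrix mm mm ℂ)))
      (fun y y' => R₁ * K * Real.exp (-(δ * (unitTorusGeo L kk (cvM d L mv kk hL)).dist y y'))) := by
    refine hNV.mono fun y y' => ?_
    rw [unitTorusGeo_dist]
    exact mul_le_mul_of_nonneg_right hconst (Real.exp_nonneg _)
  have hRK0 : 0 ≤ R₁ * K := mul_nonneg (by rw [hR₁def]; positivity) hK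
  have hsand : ∀ (ψ χ : CvX d L mv kk hL → ℝ), (∀ x, |ψ x| ≤ 1) → (∀ x, |χ x| ≤ 1) →
      HasMaj (CvNorm d L mv kk hL ι) (CvNorm d L mv kk hL ι) (mulOp (fun p : CvX d L mv kk hL × ι => ψ p.1) ∘ₗ
        cvNVq d L mv kk hL a ι e (fun μ x => (fluct ((((L ^ kk : ℕ) : ℝ))⁻¹) A μ x : Matrix mm mm ℂ)) ∘ₗ mulOp (fun p : CvX d L mv kk hL × ι => χ p.1))
      (fun y y' => R₁ * K * Real.exp (-(δ * (unitTorusGeo L kk (cvM d L mv kk hL)).dist y y'))) := fun ψ χ hψ hχ => by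
    exact hasMaj_sandwich_of_abs_le_one (g := unitTorusGeo L kk (cvM d L mv kk hL)) (liftBlk (cvBlk d L mv kk hL) ι)
      (N := cvNVq d L mv kk hL a ι e (fun μ x => (fluct ((((L ^ kk : ℕ) : ℝ))⁻¹) A μ x : Matrix mm mm ℂ)))
      (K := fun y y' => R₁ * K * Real.exp (-(δ * (unitTorusGeo L kk (cvM d L mv kk hL)).dist y y')))
      (ψ := fun p : CvX d L mv kk hL × ι => ψ p.1) (χ := fun p : CvX d L mv kk hL × ι => χ p.1)
      (fun p => hψ p.1) (fun p => hχ p.1) (fun y y' => mul_nonneg hRK0 (Real.exp_nonneg _)) hNV'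
  have hRle' : rV * (1 + Fintype.card (Fin (d + 1) ⊕ Fin (d + 1))) + (R₁ * K + RR) ≤ R₀ := by linarith [hRle.trans (min_le_left R₀ θ₀)]
  have hθle : R₁ * K + θR ≤ θ₀ := hθRle.trans (min_le_right R₀ θ₀)
  have hRK0' : 0 ≤ R₁ * K + RR := add_nonneg hRK0 hRR
  have hθ0' : 0 ≤ R₁ * K + θR := add_nonneg hRK0 hθR
  -- the near ∕ far rows of `N_V^Q + N_V^R`: the `N_V^Q` part by the sandwich (n15-c∕182b), the `N_V^R` part displayed
  have hsplit : ∀ (Z : (CvX d L mv kk hL × ι → ℝ) →ₗ[ℝ] (CvX d L mv kk hL × ι → ℝ)) (k : Fin (d + 1) → ZMod (2 * L)),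
      Z ∘ₗ (cvNVq d L mv kk hL a ι e (fun μ x => (fluct ((((L ^ kk : ℕ) : ℝ))⁻¹) A μ x : Matrix mm mm ℂ)) + cvNVr d L mv kk hL a ι e (fun μ x => (fluct ((((L ^ kk : ℕ) : ℝ))⁻¹) A μ x : Matrix mm mm ℂ))) ∘ₗ mulOp (fun p : CvX d L mv kk hL × ι => cvChi d L mv kk hL k p.1) =
        Z ∘ₗ cvNVq d L mv kk hL a ι e (fun μ x => (fluct ((((L ^ kk : ℕ) : ℝ))⁻¹) A μ x : Matrix mm mm ℂ)) ∘ₗ mulOp (fun p : CvX d L mv kk hL × ι => cvChi d L mv kk hL k p.1) +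
          Z ∘ₗ cvNVr d L mv kk hL a ι e (fun μ x => (fluct ((((L ^ kk : ℕ) : ℝ))⁻¹) A μ x : Matrix mm mm ℂ)) ∘ₗ mulOp (fun p : CvX d L mv kk hL × ι => cvChi d L mv kk hL k p.1) := fun Z k => by
    rw [LinearMap.add_comp, LinearMap.comp_add]
  exact H mv kk hk hw₀ e he (fun _ _ => 1) (fun _ _ => by rw [Matrix.conjTranspose_one, Matrix.mul_one]) (fun μ x => (fluct ((((L ^ kk : ℕ) : ℝ))⁻¹) A μ x : Matrix mm mm ℂ))
    (cvNL d L mv kk hL a ι - cvNVq d L mv kk hL a ι e (fun μ x => (fluct ((((L ^ kk : ℕ) : ℝ))⁻¹) A μ x : Matrix mm mm ℂ)) - cvNVr d L mv kk hL a ι e (fun μ x => (fluct ((((L ^ kk : ℕ) : ℝ))⁻¹) A μ x : Matrix mm mm ℂ)))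
    (fun _ => cvNVq d L mv kk hL a ι e (fun μ x => (fluct ((((L ^ kk : ℕ) : ℝ))⁻¹) A μ x : Matrix mm mm ℂ)) + cvNVr d L mv kk hL a ι e (fun μ x => (fluct ((((L ^ kk : ℕ) : ℝ))⁻¹) A μ x : Matrix mm mm ℂ))) rV (R₁ * K + RR) (R₁ * K + θR) hrV hRK0' hθ0' hRle' hθle
    (fun k => by rw [conj_one_eq_sub_zero, sub_zero, sub_sub])
    (fun k x _ i => ((hlet x).2 i).trans hrC) (fun k j' x _ i => ((hlet x).1 j' i).trans hrA)
    (fun k => by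
      rw [hsplit]
      exact ((hsand _ _ (fun x => abs_chiCube_le_one _ x) (fun x => abs_chiCube_le_one _ x)).add (hNr k)).mono fun y y' => (add_mul _ _ _).symm.le)
    (fun k => by
      have hψ : ∀ x : CvX d L mv kk hL, |(1 - cvPsi d L mv kk hL k) x| ≤ 1 := fun x => by
        rw [Pi.sub_apply, Pi.one_apply]
        unfold cvPsi chiCube
        split_ifs <;> simp
      have h := hsand (1 - cvPsi d L mv kk hL k) (cvChi d L mv kk hL k) hψ (fun x => abs_chiCube_le_one _ x)
      have hid : (LinearMap.id - mulOp (fun p : CvX d L mv kk hL × ι => cvPsi d L mv kk hL k p.1)) =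
          mulOp (fun p : CvX d L mv kk hL × ι => (1 - cvPsi d L mv kk hL k) p.1) :=
        LinearMap.ext fun f => funext fun p => by simp [mulOp_apply, sub_mul]
      rw [← hid] at h
      rw [hsplit]
      exact (h.add (hFr k)).mono fun y y' => (add_mul _ _ _).symm.le)


end Knit

end Summit.QuantumFields.YangMills.BalabanUVNodes.N15.Gluing

end
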